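import Summits.CriticalPhenomena.PercolationContinuityZ3.Theorems.PercLowPointHalfSpaceTallClusterMassBoundTightnessGlue
import Summits.CriticalPhenomena.PercolationContinuityZ3.Theorems.PercLowPointHalfSpaceTallClusterMassBoundStubFirstMomentTransfer
import Summits.CriticalPhenomena.PercolationContinuityZ3.Theorems.PercLowPointHalfSpaceTallClusterMassBoundStubKLVolumeTail
import Summits.CriticalPhenomena.PercolationContinuityZ3.Theorems.PercLowPointHalfSpaceTallClusterMassBoundStubCrossoverTransfer

/-!
# `TallClusterMassBound` (stmt-CriticalPhenomena-0912), line `SketchIdeator4` (universal tightness):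
# the three ENGINES composed — B from a critical volume tail, from a subcritical susceptibility exponent, from a surface crossover profile

Glue of the line (crux `…Theses.PercLowPointHalfSpace.TallClusterMassBound`, item B of route PercLowPointHalfSpace), sorry-free,
hypotheses explicit; each composes a landed engine stub with `tallClusterMassBound_of_halfBoxTypicalMax` (B ⟸ C⁺):

* `tallClusterMassBound_of_volumeTail` : a bulk critical volume tail `P_{p_c}(|C(0)| ≥ n) ≤ C n^{-θ}` with `1/11 < θ ≤ 1`
  ("`δ < 11`") gives B (ARROW 2 `stub_firstMomentTransfer`; `3/(1+θ) < 11/4 ⟺ θ > 1/11`). This input is a quantitative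
  `θ(p_c) = 0` statement (it closes the summit by itself) — recorded as the calibration of the lever.
* `tallClusterMassBound_of_subcritGamma` : a subcritical susceptibility bound `χ(p) ≤ C (p_c - p)^{-γ}`, `1 ≤ γ < 20/11`, gives B
  (ARROW 3 `stub_klVolumeTail`, then the previous item with `θ = 1 - γ/2`). Also summit-closing by itself.
* `tallClusterMassBound_of_surfaceCrossover` : a subcritical SURFACE susceptibility profile bound
  `Σ_{x ∈ B_R} P_p((h,0,0) ↔_ℍ x) ≤ C (p_c - p)^{-γ₁} (1+h)^κ` (all `p < p_c`, `h`, `R`) with `1 ≤ γ₁`, `0 ≤ κ`,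
  `11γ₁ + 8κ < 20` gives B (ARROW 2′ `stub_crossoverTransfer`; `(3+κ)/(2-γ₁/2) < 11/4 ⟺ 11γ₁ + 8κ < 20`).
  This input is NOT known to close the summit.

Nothing here asserts any of the three inputs; all are open for `ℤ³`.
-/

noncomputable section

open MeasureTheory Finset Filter
open Literature.Probability.Percolation Literature.Probability.LatticeModels
open Summit.CriticalPhenomena.PercolationContinuityZ3.Theses.PercLowPointHalfSpace (TallClusterMassBound)
open Summit.CriticalPhenomena.PercolationContinuityZ3.Theorems.TallClusterMassBound.Negative

namespace Summit.CriticalPhenomena.PercolationContinuityZ3.Theorems.TallClusterMassBound.TightnessLine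

/-- **B from a bulk critical volume tail with exponent `θ > 1/11` ("`δ < 11`").** [folklore] -/
theorem tallClusterMassBound_of_volumeTail :
    ∀ {θ C : ℝ}, (1 : ℝ) / 11 < θ → θ ≤ 1 →
      (∀ n : ℕ, 1 ≤ n → (Pp (criticalProbI 3)).real (clusterSizeGe (0 : V3) n) ≤ C * (n : ℝ) ^ (-θ)) →
      TallClusterMassBound := by
  intro θ C hθ hθ1 hV
  have hθpos : 0 < θ := by linarith
  obtain ⟨C', hC'⟩ := stub_firstMomentTransfer θ C hθpos hθ1 hV
  refine tallClusterMassBound_of_halfBoxTypicalMax ⟨3 / (1 + θ), ?_, C', hC'⟩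
  have hden : 0 < 1 + θ := by linarith
  rw [div_lt_div_iff₀ hden (by norm_num : (0 : ℝ) < 4)]
  nlinarith

/-- **B from a subcritical susceptibility exponent bound `γ < 20/11`** (`χ(p) ≤ C (p_c - p)^{-γ}` for all `p < p_c`). [folklore] -/
theorem tallClusterMassBound_of_subcritGamma :
    ∀ {γ C : ℝ}, 1 ≤ γ → γ < (20 : ℝ) / 11 →
      (∀ p : unitInterval, (p : ℝ) < criticalProb (zdGraph 3) (0 : V3) →
        chi 3 p ≤ C * (criticalProb (zdGraph 3) (0 : V3) - (p : ℝ)) ^ (-γ)) →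
      TallClusterMassBound := by
  intro γ C hγ1 hγ hS
  have hγ2 : γ < 2 := by linarith
  obtain ⟨C', hC'⟩ := stub_klVolumeTail γ C hγ1 hγ2 hS
  exact tallClusterMassBound_of_volumeTail (θ := 1 - γ / 2) (by linarith) (by linarith) hC'

/-- **B from a subcritical surface susceptibility profile bound with `11γ₁ + 8κ < 20`.** [folklore] -/
theorem tallClusterMassBound_of_surfaceCrossover :
    ∀ {γ₁ κ C : ℝ}, 1 ≤ γ₁ → 0 ≤ κ → 11 * γ₁ + 8 * κ < 20 →
      (∀ p : unitInterval, (p : ℝ) < criticalProb (zdGraph 3) (0 : V3) → ∀ h R : ℕ,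
        ∑ x ∈ box 3 R, (Pp p).real (openConnIn Hs (up h) x) ≤
          C * (criticalProb (zdGraph 3) (0 : V3) - (p : ℝ)) ^ (-γ₁) * ((h : ℝ) + 1) ^ κ) →
      TallClusterMassBound := by
  intro γ₁ κ C hγ hκ hlin hS
  have hγ2 : γ₁ < 2 := by nlinarith
  obtain ⟨C', hC'⟩ := stub_crossoverTransfer γ₁ κ C hγ hγ2 hκ hS
  refine tallClusterMassBound_of_halfBoxTypicalMax ⟨(3 + κ) / (2 - γ₁ / 2), ?_, C', hC'⟩
  have hden : 0 < 2 - γ₁ / 2 := by linarith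
  rw [div_lt_div_iff₀ hden (by norm_num : (0 : ℝ) < 4)]
  nlinarith

end Summit.CriticalPhenomena.PercolationContinuityZ3.Theorems.TallClusterMassBound.TightnessLine
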